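import Summits.Ventures.PercRepro.S1TrianglePlusCone

/-!
# PercRepro — THE FREE CONE, part A: sub-ranks, coloops outside a full-nullity set, and the free-cone exclusion
(p1, gen 20; building blocks of LEMMA T⁺⁺, (C1) only)

Setting: (C1) (every rank-`2` set has `≤ 3` points), `x` a non-loop, `s` a set of triangles through `x`,
`U = {x} ∪ ⋃ s` the cone (`|U| = 2#s + 1`, `r(U) ≤ #s + 1`, TriangleStar). The cone is FREE when `r(U) = #s + 1`.

* `eRk_cone_sub_eq` — in a free cone every sub-family `s₀ ⊆ s` spans rank exactly `1 + #s₀`;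
* `IsCircuit.subset_of_eRk_add_encard_le` — if `r(W) + |E ∖ W| ≤ r(E)` then every circuit lies inside `W`
  (the points outside `W` are coloops);
* **`not_subset_cone_of_free`** — under (C1), if `s` is the set of ALL triangles through `x` and the cone is
  free, no triangle avoiding `x` lies inside the cone: either it contains both points of a triangle through `x`
  (a 4-point line) or it meets three triangles through `x` in one point each (those three lie in a rank-`3`
  set, and the cone's rank drops below `#s + 1`).
Axioms: standard.
-/

open scoped Matroid

namespace PercRepro

namespace S1

open Set

variable {α : Type}

/-- In a free cone (`r({x} ∪ ⋃ s) = 1 + #s`), every sub-family `s₀ ⊆ s` of triangles through `x` spans rank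
exactly `1 + #s₀`. -/
theorem eRk_cone_sub_eq (M : Matroid α) [M.Finite]
    (hC1 : ∀ L ⊆ M.E, M.eRk L = 2 → L.ncard ≤ 3) {x : α} (hx : M.IsNonloop x)
    (s : Finset (Set α)) (hs : ∀ C ∈ s, C ∈ ThmN.trianglesThrough M x)
    (hfree : M.eRk ({x} ∪ ⋃ C ∈ s, C) = ((1 + s.card : ℕ) : ℕ∞))
    (s₀ : Finset (Set α)) (hs₀ : s₀ ⊆ s) :
    M.eRk ({x} ∪ ⋃ C ∈ s₀, C) = ((1 + s₀.card : ℕ) : ℕ∞) := by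
  classical
  have hs₀' : ∀ C ∈ s₀, C ∈ ThmN.trianglesThrough M x := fun C hC => hs C (hs₀ hC)
  have hle := (ThmN.eRk_le_and_ncard_eq_of_triangles M hC1 hx s₀ hs₀').1
  have hrest : ∀ C ∈ s \ s₀, C ∈ ThmN.trianglesThrough M x :=
    fun C hC => hs C (Finset.mem_sdiff.1 hC).1
  have hsub : ({x} ∪ ⋃ C ∈ s, C) ⊆ ({x} ∪ ⋃ C ∈ s₀, C) ∪ ⋃ C ∈ s \ s₀, C := by
    intro z hz
    rcases hz with hz | hz
    · exact Set.mem_union_left _ (Set.mem_union_left _ hz)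
    · obtain ⟨C, hC, hzC⟩ := Set.mem_iUnion₂.1 hz
      by_cases hC₀ : C ∈ s₀
      · exact Set.mem_union_left _ (Set.mem_union_right _ (Set.mem_iUnion₂.2 ⟨C, hC₀, hzC⟩))
      · exact Set.mem_union_right _ (Set.mem_iUnion₂.2 ⟨C, Finset.mem_sdiff.2 ⟨hC, hC₀⟩, hzC⟩)
  have hge : M.eRk ({x} ∪ ⋃ C ∈ s, C) ≤ M.eRk ({x} ∪ ⋃ C ∈ s₀, C) + (s \ s₀).card := by
    calc M.eRk ({x} ∪ ⋃ C ∈ s, C) ≤ M.eRk (({x} ∪ ⋃ C ∈ s₀, C) ∪ ⋃ C ∈ s \ s₀, C) := M.eRk_mono hsub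
      _ ≤ M.eRk ({x} ∪ ⋃ C ∈ s₀, C) + (s \ s₀).card :=
          eRk_union_biUnion_le M hx (Set.mem_union_left _ (Set.mem_singleton x)) (s \ s₀) hrest
  have hcard : (s \ s₀).card + s₀.card = s.card := Finset.card_sdiff_add_card_eq_card hs₀
  have hne : M.eRk ({x} ∪ ⋃ C ∈ s₀, C) ≠ ⊤ := by
    intro h; rw [h] at hle; exact absurd hle (by simp)
  obtain ⟨a, ha⟩ := ENat.ne_top_iff_exists.1 hne
  rw [← ha] at hle hge ⊢
  rw [hfree] at hge
  have e1 : a ≤ 1 + s₀.card := by exact_mod_cast hle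
  have e2 : 1 + s.card ≤ a + (s \ s₀).card := by exact_mod_cast hge
  have : a = 1 + s₀.card := by omega
  rw [this]

/-- If `r(W) + |E ∖ W| ≤ r(E)` (the points outside `W` are coloops), every circuit lies inside `W`. -/
theorem IsCircuit.subset_of_eRk_add_encard_le (M : Matroid α) [M.Finite] {W : Set α} (hW : W ⊆ M.E)
    (hr : M.eRk W + (M.E \ W).encard ≤ M.eRank) {C : Set α} (hC : M.IsCircuit C) : C ⊆ W := by
  by_contra hnot
  obtain ⟨z, hzC, hzW⟩ := Set.not_subset.1 hnot
  have hCE : C ⊆ M.E := hC.subset_ground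
  have hzE : z ∈ M.E := hCE hzC
  have hzcl : z ∈ M.closure (M.E \ {z}) := by
    have h1 : z ∈ M.closure (C \ {z}) := hC.mem_closure_sdiff_singleton_of_mem hzC
    exact M.closure_subset_closure (Set.sdiff_subset_sdiff_left hCE) h1
  have hrEz : M.eRk (M.E \ {z}) = M.eRank := by
    apply le_antisymm
    · rw [← M.eRk_ground]; exact M.eRk_mono Set.sdiff_subset
    · have hsub : M.E ⊆ M.closure (M.E \ {z}) := by
        intro w hw
        by_cases hwz : w = z
        · rw [hwz]; exact hzcl
        · exact M.subset_closure (M.E \ {z}) Set.sdiff_subset ⟨hw, hwz⟩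
      calc M.eRank = M.eRk M.E := M.eRank_def
        _ ≤ M.eRk (M.closure (M.E \ {z})) := M.eRk_mono hsub
        _ = M.eRk (M.E \ {z}) := M.eRk_closure_eq _
  have hzEW : z ∈ M.E \ W := ⟨hzE, hzW⟩
  have hsplit : M.E \ {z} = W ∪ ((M.E \ W) \ {z}) := by
    ext w
    simp only [Set.mem_sdiff, Set.mem_singleton_iff, Set.mem_union]
    constructor
    · rintro ⟨hwE, hwz⟩
      by_cases hwW : w ∈ W
      · exact Or.inl hwW
      · exact Or.inr ⟨⟨hwE, hwW⟩, hwz⟩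
    · rintro (hwW | ⟨⟨hwE, -⟩, hwz⟩)
      · exact ⟨hW hwW, fun h => hzW (h ▸ hwW)⟩
      · exact ⟨hwE, hwz⟩
  have hle : M.eRk (M.E \ {z}) ≤ M.eRk W + ((M.E \ W) \ {z}).encard := by
    rw [hsplit]; exact M.eRk_union_le_eRk_add_encard _ _
  have hcz : ((M.E \ W) \ {z}).encard + 1 = (M.E \ W).encard :=
    Set.encard_sdiff_singleton_add_one hzEW
  have hWfin : W.Finite := M.ground_finite.subset hW
  have hneW : M.eRk W ≠ ⊤ := ((M.eRk_le_encard _).trans_lt hWfin.encard_lt_top).ne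
  obtain ⟨a, ha⟩ := ENat.ne_top_iff_exists.1 hneW
  have hneR : M.eRank ≠ ⊤ :=
    (M.eRank_le_encard_ground.trans_lt M.ground_finite.encard_lt_top).ne
  obtain ⟨r, hr'⟩ := ENat.ne_top_iff_exists.1 hneR
  rw [hrEz, ← hr', ← ha, ← (M.ground_finite.sdiff.sdiff (t := {z})).cast_ncard_eq] at hle
  rw [← hr', ← ha, ← (M.ground_finite.sdiff (t := W)).cast_ncard_eq] at hr
  rw [← (M.ground_finite.sdiff.sdiff (t := {z})).cast_ncard_eq,
    ← (M.ground_finite.sdiff (t := W)).cast_ncard_eq] at hcz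
  have e1 : r ≤ a + ((M.E \ W) \ {z}).ncard := by exact_mod_cast hle
  have e2 : a + (M.E \ W).ncard ≤ r := by exact_mod_cast hr
  have e3 : ((M.E \ W) \ {z}).ncard + 1 = (M.E \ W).ncard := by exact_mod_cast hcz
  omega

/-- **The free-cone exclusion.** Under (C1), if `s` is the set of ALL triangles through the non-loop `x` and the
cone `{x} ∪ ⋃ s` is free (`r = 1 + #s`), then no triangle avoiding `x` lies inside the cone. -/
theorem not_subset_cone_of_free (M : Matroid α) [M.Finite]
    (hC1 : ∀ L ⊆ M.E, M.eRk L = 2 → L.ncard ≤ 3) {x : α} (hx : M.IsNonloop x)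
    (s : Finset (Set α)) (hmem : ∀ C, C ∈ s ↔ C ∈ ThmN.trianglesThrough M x)
    (hfree : M.eRk ({x} ∪ ⋃ C ∈ s, C) = ((1 + s.card : ℕ) : ℕ∞))
    {T : Set α} (hT : T ∈ ThmN.triangles M) (hxT : x ∉ T) (hTU : T ⊆ {x} ∪ ⋃ C ∈ s, C) : False := by
  classical
  have hs : ∀ C ∈ s, C ∈ ThmN.trianglesThrough M x := fun C hC => (hmem C).1 hC
  have hTE : T ⊆ M.E := hT.1.subset_ground
  have hTfin : T.Finite := M.ground_finite.subset hTE
  have hT3 : T.ncard = 3 := hT.2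
  set U : Set α := {x} ∪ ⋃ C ∈ s, C with hU
  -- `T` avoids `x`, so it lies in the union of the triangles through `x`
  have hTs : ∀ w ∈ T, ∃ C ∈ s, w ∈ C := by
    intro w hw
    rcases hTU hw with h | h
    · exact absurd (Set.mem_singleton_iff.1 h ▸ hw) hxT
    · obtain ⟨C, hC, hwC⟩ := Set.mem_iUnion₂.1 h
      exact ⟨C, hC, hwC⟩
  -- case (a) — some triangle through `x` has both its other points in `T`
  by_cases hcaseA : ∃ C ∈ s, ∃ a ∈ T, ∃ b ∈ T, a ≠ b ∧ a ∈ C ∧ b ∈ C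
  · obtain ⟨C, hCs, a, haT, b, hbT, hab, haC, hbC⟩ := hcaseA
    have hC := hs C hCs
    have hCfin : C.Finite := M.ground_finite.subset hC.1.subset_ground
    have hax : a ≠ x := fun h => hxT (h ▸ haT)
    have hbx : b ≠ x := fun h => hxT (h ▸ hbT)
    have hCeq : C = {x, a, b} := by
      symm
      apply Set.eq_of_subset_of_ncard_le
      · intro w hw
        simp only [Set.mem_insert_iff, Set.mem_singleton_iff] at hw
        rcases hw with rfl | rfl | rfl
        · exact hC.2.2
        · exact haC
        · exact hbC
      · rw [hC.2.1]
        have h3 : ({x, a, b} : Set α).ncard = 3 := by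
          rw [Set.ncard_insert_of_notMem, Set.ncard_pair hab]
          simp only [Set.mem_insert_iff, Set.mem_singleton_iff, not_or]
          exact ⟨Ne.symm hax, Ne.symm hbx⟩
        rw [h3]
      · exact hCfin
    have hxcl : x ∈ M.closure T := by
      have h1 : x ∈ M.closure (C \ {x}) := hC.1.mem_closure_sdiff_singleton_of_mem hC.2.2
      have h2 : C \ {x} ⊆ T := by
        intro w hw
        rw [hCeq] at hw
        obtain ⟨hw1, hw2⟩ := hw
        simp only [Set.mem_insert_iff, Set.mem_singleton_iff] at hw1
        rcases hw1 with rfl | rfl | rfl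
        · exact absurd rfl hw2
        · exact haT
        · exact hbT
      exact M.closure_subset_closure h2 h1
    have hrT : M.eRk T = 2 := ThmN.eRk_eq_two_of_mem_trianglesThrough M ⟨hT.1, hT.2, haT⟩
    have hrTx : M.eRk (insert x T) = 2 := by
      apply le_antisymm
      · have hsub : insert x T ⊆ M.closure T :=
          Set.insert_subset hxcl (M.subset_closure T hTE)
        calc M.eRk (insert x T) ≤ M.eRk (M.closure T) := M.eRk_mono hsub
          _ = 2 := by rw [M.eRk_closure_eq, hrT]
      · rw [← hrT]; exact M.eRk_mono (Set.subset_insert x T)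
    have hTxE : insert x T ⊆ M.E := Set.insert_subset hx.mem_ground hTE
    have h4 : (insert x T).ncard = 4 := by
      rw [Set.ncard_insert_of_notMem hxT hTfin, hT3]
    have := hC1 (insert x T) hTxE hrTx
    omega
  -- case (b) — every triangle through `x` meets `T` in at most one point
  have hcaseB : ∀ C ∈ s, ∀ a ∈ T, ∀ b ∈ T, a ∈ C → b ∈ C → a = b := by
    intro C hC a ha b hb haC hbC
    by_contra hne
    exact hcaseA ⟨C, hC, a, ha, b, hb, hne, haC, hbC⟩
  set s' : Finset (Set α) := s.filter (fun C => ∃ w ∈ T, w ∈ C) with hs'def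
  have hs'sub : s' ⊆ s := Finset.filter_subset _ _
  have hchoice : ∀ w, w ∈ T → ∃ C, C ∈ s' ∧ w ∈ C := by
    intro w hw
    obtain ⟨C, hCs, hwC⟩ := hTs w hw
    exact ⟨C, Finset.mem_filter.2 ⟨hCs, w, hw, hwC⟩, hwC⟩
  have h3le : 3 ≤ s'.card := by
    let f : α → Set α := fun w => if h : w ∈ T then Classical.choose (hchoice w h) else ∅
    have hf : ∀ w ∈ T, f w ∈ (↑s' : Set (Set α)) := by
      intro w hw
      simp only [f, dif_pos hw]
      exact Finset.mem_coe.2 (Classical.choose_spec (hchoice w hw)).1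
    have hfw : ∀ w (hw : w ∈ T), w ∈ f w := by
      intro w hw
      simp only [f, dif_pos hw]
      exact (Classical.choose_spec (hchoice w hw)).2
    have hinj : Set.InjOn f T := by
      intro u hu v hv huv
      have hu' : u ∈ f u := hfw u hu
      have hv' : v ∈ f u := huv ▸ hfw v hv
      have hfs : f u ∈ s := hs'sub (Finset.mem_coe.1 (hf u hu))
      exact hcaseB (f u) hfs u hu v hv hu' hv'
    have := Set.ncard_le_ncard_of_injOn f hf hinj (Finset.finite_toSet s')
    rw [hT3, Set.ncard_coe_finset] at this
    exact this
  set V : Set α := insert x T with hV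
  have hVE : V ⊆ M.E := Set.insert_subset hx.mem_ground hTE
  have hrV : M.eRk V ≤ 3 := by
    have hrT : M.eRk T = 2 := by
      obtain ⟨w, hw⟩ := hT.1.nonempty
      exact ThmN.eRk_eq_two_of_mem_trianglesThrough M ⟨hT.1, hT.2, hw⟩
    calc M.eRk V ≤ M.eRk T + 1 := M.eRk_insert_le_add_one x T
      _ = 3 := by rw [hrT]; norm_num
  have hs'cl : ∀ C ∈ s', C ⊆ M.closure V := by
    intro C hC
    obtain ⟨hCs, w, hwT, hwC⟩ := Finset.mem_filter.1 hC
    have hC' := hs C hCs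
    have hwx : w ≠ x := fun h => hxT (h ▸ hwT)
    have hpair : ({x, w} : Set α) ⊆ V := by
      intro u hu
      simp only [Set.mem_insert_iff, Set.mem_singleton_iff] at hu
      rcases hu with rfl | rfl
      · exact Set.mem_insert u T
      · exact Set.mem_insert_of_mem x hwT
    have hpairC : ({x, w} : Set α) ⊆ C := by
      intro u hu
      simp only [Set.mem_insert_iff, Set.mem_singleton_iff] at hu
      rcases hu with rfl | rfl
      · exact hC'.2.2
      · exact hwC
    have hCfin : C.Finite := M.ground_finite.subset hC'.1.subset_ground
    have hpair_ssub : ({x, w} : Set α) ⊂ C := by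
      refine hpairC.ssubset_of_ne ?_
      intro h
      have := congrArg Set.ncard h
      rw [Set.ncard_pair (Ne.symm hwx), hC'.2.1] at this
      omega
    have hpair_indep : M.Indep ({x, w} : Set α) := hC'.1.ssubset_indep hpair_ssub
    have hpair_rk : M.eRk ({x, w} : Set α) = 2 := by
      rw [hpair_indep.eRk_eq_encard, Set.encard_pair (Ne.symm hwx)]
    have hCcl : C ⊆ M.closure ({x, w} : Set α) :=
      ThmN.subset_closure_of_eRk_le M hpairC hC'.1.subset_ground hCfin
        (by rw [ThmN.eRk_eq_two_of_mem_trianglesThrough M hC', hpair_rk])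
    exact hCcl.trans (M.closure_subset_closure hpair)
  have hW : M.eRk (V ∪ ⋃ C ∈ s', C) ≤ 3 := by
    have hsub : V ∪ ⋃ C ∈ s', C ⊆ M.closure V := by
      apply Set.union_subset (M.subset_closure V hVE)
      exact Set.iUnion₂_subset hs'cl
    calc M.eRk (V ∪ ⋃ C ∈ s', C) ≤ M.eRk (M.closure V) := M.eRk_mono hsub
      _ = M.eRk V := M.eRk_closure_eq V
      _ ≤ 3 := hrV
  have hxVW : x ∈ V ∪ ⋃ C ∈ s', C := Set.mem_union_left _ (Set.mem_insert x T)
  have hrest : ∀ C ∈ s \ s', C ∈ ThmN.trianglesThrough M x :=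
    fun C hC => hs C (Finset.mem_sdiff.1 hC).1
  have hUsub : U ⊆ (V ∪ ⋃ C ∈ s', C) ∪ ⋃ C ∈ s \ s', C := by
    intro z hz
    rcases hz with hz | hz
    · rw [Set.mem_singleton_iff.1 hz]
      exact Set.mem_union_left _ (Set.mem_union_left _ (Set.mem_insert x T))
    · obtain ⟨C, hC, hzC⟩ := Set.mem_iUnion₂.1 hz
      by_cases hC' : C ∈ s'
      · exact Set.mem_union_left _ (Set.mem_union_right _ (Set.mem_iUnion₂.2 ⟨C, hC', hzC⟩))
      · exact Set.mem_union_right _ (Set.mem_iUnion₂.2 ⟨C, Finset.mem_sdiff.2 ⟨hC, hC'⟩, hzC⟩)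
  have hrU' : M.eRk U ≤ 3 + ((s \ s').card : ℕ∞) := by
    calc M.eRk U ≤ M.eRk ((V ∪ ⋃ C ∈ s', C) ∪ ⋃ C ∈ s \ s', C) := M.eRk_mono hUsub
      _ ≤ M.eRk (V ∪ ⋃ C ∈ s', C) + (s \ s').card :=
          eRk_union_biUnion_le M hx hxVW (s \ s') hrest
      _ ≤ 3 + (s \ s').card := by gcongr
  have hsdcard : (s \ s').card + s'.card = s.card := Finset.card_sdiff_add_card_eq_card hs'sub
  rw [hfree] at hrU'
  have e5 : 1 + s.card ≤ 3 + (s \ s').card := by exact_mod_cast hrU'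
  omega


end S1

end PercRepro
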